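/-
Copyright: cell pub-balaban-gaps (YM BLITZ Y1, track G1), seat g1-p2 GEN 7 (unit `pub-balaban-gaps-g1-p2`).  Row (D4) NODE O,
OBJECT ∕ MECHANISM level: [B9] Sect. B's perturbation step (3.60)–(3.65) in the BLOCK currency WITH DERIVATIVE LETTERS — the
mechanism by which print's constants stay k-UNIFORM on the (F)-half: the perturbation `V′(A)` is small (`α₁`) only AGAINST THE
GRADIENT ((3.61)), the covariant differences `∇_U` (size `η⁻¹`) are absorbed into the DERIVATIVE ENTRIES of (3.42), never into a
norm of `V′`.  HONEST FRAMING: bookkeeping over hypothesis SHAPES at MODEL generality; nothing of Bałaban's `Δ_U`, `∇_U`, `V′(A)`,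
`G′(U)` constructed or asserted; (D4) NOT discharged (instance 0∕1); NOT BetaPertH, NOT continuum, NOT Clay.
-/
import Summits.QuantumFields.BalabanUV.Gaps.D4WalkBlockGlue

/-!
# `Gaps.D4WalkBlockDerivative` — derivative letters in the block walk currency and [B9] Sect. B's perturbation step
# (3.60)–(3.65) with a margin free of `‖∇‖` (cell pub-balaban-gaps, seat g1-p2 gen 7)

HONEST DEPENDENCY (cell pub-balaban, verbatim): continuum YM on T⁴ ⇐ BetaPertH ∧ nine spine estimates (0/9 proved);
BetaPertH ⇐ (D1) ∧ (D4) ∧ CAP+tail.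

WHERE THIS SITS.  The seat's (U)-road ENDs (`D4WalkBlockLocalInverse` … `D4WalkBlockCoerciveLetter`) get the decaying block letters
of the local inverses from uniform conjugated COERCIVITY (Combes–Thomas); at fine resolution that road loses `η^{−d}` per level
(entry → block; RESIDUE (D4) v1.15 L-14).  Print's road to k-uniform constants is different (p. 399: «This way the theorems are
reduced to the corresponding theorems for propagators without external gauge field. They were proved in [4].»; Sect. B
pp. 400–407; Cor. 3.5 p. 407): in a small COMPLEX background the propagators are RESOLVENT perturbations of the flat ones —
(3.60) `Δ_{U′U} + Q′*(U′U)aQ′(U′U) = Δ_U + Q′*(U)aQ′(U) − V′(A)`, (3.61) «|(V′(A)λ)(x)| ≤ O(1)α₁((Lʲη)⁻¹|∇_Uλ| + (Lʲη)⁻²|λ|) …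
the norms on the right-hand side restricted to the block B(y) containing the point x», (3.63) «|(V′(A)G′(U)λ)(x)| ≤
O(1)B₀α₁e^{−δ₀d(y,y′)}|λ|», (3.64) «G′(U′U) = G′(U)(I − V′(A)G′(U))⁻¹ = Σ_{n≥0} G′(U)(V′(A)G′(U))ⁿ» — the smallness of `V′G′` is
read off the DERIVATIVE entries of (3.42), which [4] Prop. 2.2 supplies k-uniformly at `U = 1` (tree, by name only:
`B6Prop22MultiLevelTorus`, `B6Prop22DerivMultiLevelTorus`).  THIS FILE types that mechanism over `D4WalkBlock.BlockWalkExpansion`: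
* §1 block-norm lemmas: finite sums; a CUBE-LOCAL left factor costs its diagonal block bound and NO cube sum
  (`blockNorm_localMul_le`); the (3.52)-structure `V = a₀ + Σ_μ a_μ∇_μ` (cube-local coefficients, ARBITRARY `∇_μ`) gives the
  (3.61)-shape DOMINATION LETTER `‖VS‖_{y,y′} ≤ α₀‖S‖_{y,y′} + Σ_μ α_μ‖∇_μS‖_{y,y′}` (`blockDominated_of_local`); with RELATIVE
  DERIVATIVE LETTERS `‖∇_μT‖ ≤ B_μ·F` of a term the letter of `VT` is `(α₀ + Σ_μ α_μB_μ)F` — (3.63), no `‖∇_μ‖` (`blockNorm_perturbTerm_le`).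
* §2 `BlockWalkExpansion.leftMul` (left multiplication by a σ-independent holomorphic family with a relative block letter `θ`:
  same walks, amplitudes `θA`, constant `θK̄`), `BlockWalkExpansion.congrK`.
* §3 `derivLetter_mul`: a relative derivative letter of the LEFT factor passes to a product of expansions unchanged.
* §4 **`blockWalkExpansion_perturb`** — THE STEP (3.64): `W` block-walk-expanded at `(ε_W, κ_W, K̄_W, ρ_W)` with relative derivative
  letters `B_μ`, the composite `VW` block-walk-expanded at the same rates with constant `K̄_P`, cube row sum `(μ, c_μ)`, `2μ ≤ ε_W`,
  `2μ ≤ κ_W`, `κ_W + μ ≤ ρ_W − ε_W`, MARGIN `q = c_μ(c_μ·1·(1·K̄_P)c_μ)c_μ < 1` ⟹ `W(1 − VW)⁻¹` is a block walk expansion at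
  `(ε_W − 2μ, κ_W − 2μ, c_μK̄_W(1·(1−q)⁻¹)c_μ, ρ_W − 2μ)` carrying the SAME relative derivative letters, with dominating distances
  (BY NAME: `blockWalkExpansion_one` → `D4WalkBlockNeumann.blockWalkExpansion_inv_pencil` (`t = −1`) → `D4WalkBlockProduct.
  blockWalkExpansion_mul`; derivative letters by §3).
* §5 **`blockWalkExpansion_perturb_of_derivLetters`** — THE STEP FROM THE LETTERS (3.61) ∕ (3.42): `K̄_P = (α₀ + Σ_μ α_μB_μ)K̄_W`; the
  margin is «α₁ sufficiently small» against `(c_μ, K̄_W, B_μ)` ONLY — print's Cor. 3.5 threshold `a₁` —, the output has the input's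
  shape (the step ITERATES: print perturbs around a general `U`), and no constant depends on `∇_μ`.
* §6 `perturb_kernel_eq_inv`: `ΔW = 1`, `1 − VW` invertible ⟹ `W(1 − VW)⁻¹ = (Δ − V)⁻¹` ((3.62) ∕ (3.64)).
TREE NEIGHBOURS (by name, not imported; cell lit-balaban): the OPERATOR-level Sect. B chain is certified in `HasMajorant` form —
`B9Eq360Vprime` ((3.60) `vPrime`, (3.61) proved in the block model), `B6RandomWalkHom.b9_363_of_361` ((3.63)), `B9Thm34Ext` ∕
`B9Thm34AllKernelUniform` ((3.64)–(3.65), Thm 3.4 ⇐ Thms 3.1–3.3, one `a₁`); the flat inputs `B6Prop22MultiLevelTorus.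
prop22_first_multiLevelTorus` (value) and `B6Prop22DerivMultiLevelTorus.prop22_second_multiLevelTorus` (`dT μ * G′`, i.e. a
derivative letter) are k-uniform there.  THIS FILE is the same step at the level of the s-DECORATED WALK EXPANSION (per-term
letters, σ-structure, termwise holomorphy — the (D4) NODE-O currency `BlockWalkExpansion`), which the operator-level chain does not give.
WHAT IT IS NOT.  Bałaban's `Δ_U`, `∇_U`, `V′(A)`; the FLAT expansion with its derivative letters in THIS currency (junction with the
B6 lineage's `geomT`∕`HasMajorant` = a geometry identification, not typed here); the Hölder ∕ `L²` members of (3.42)–(3.47); the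
operators `(Q′G′²Q′*)⁻¹`, `R`, `G` of (3.65)′–(3.86); the gauge covariance of Cor. 3.6; (D4) instance 0∕1; words of row (D4) UNCHANGED.

References: T. Bałaban, Comm. Math. Phys. **99** (1985) 389–434 [B9] pp. 397, 399, 400–403, 407–410, 416; Comm. Math. Phys.
**96** (1984) 223–250 [4], Prop. 2.2 (2.67) p. 234; Comm. Math. Phys. **116** (1988) 1–22 [II], (1.11) p. 5, p. 13, p. 15.
-/

noncomputable section

namespace Summit.QuantumFields.BalabanUV.Gaps.D4WalkBlockDerivative

open Metric Set Finset
open Literature.MathematicalPhysics.QuantumFieldTheory.Balaban1983to89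
open Literature.MathematicalPhysics.QuantumFieldTheory.Balaban1983to89.B9SectDWalk
  (Through MajSumLe DomBy infConv chainConst chainDist)
open Literature.MathematicalPhysics.QuantumFieldTheory.Balaban1983to89.B9Thm34Ext (toB6)
open Literature.MathematicalPhysics.QuantumFieldTheory.Balaban1983to89.B9Thm37GlueTorus (torusGeom tdist1 tdist1_nonneg)
open Literature.MathematicalPhysics.QuantumFieldTheory.Balaban1983to89.TreeLengthTorus (TPt)
open Literature.MathematicalPhysics.QuantumFieldTheory.Balaban1983to89.B5TorusCover (UT)
open Literature.MathematicalPhysics.QuantumFieldTheory.Balaban1983to89.B11SectG (RowSum)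
open Summit.QuantumFields.BalabanUV.Gaps.D4WalkBlock
  (rowMass blockNorm blockNorm_nonneg rowMass_nonneg rowMass_le_blockNorm blockNorm_le_of_rowMass_le blockNorm_mul_le
    blockNorm_add_le BlockWalkExpansion)
open Summit.QuantumFields.BalabanUV.Gaps.D4WalkProduct (domBy_infConv_torus differentiableOn_mul_entry)
open Summit.QuantumFields.BalabanUV.Gaps.D4WalkNeumann (domBy_chain)
open Summit.QuantumFields.BalabanUV.Gaps.D4WalkBlockProduct (blockNorm_mul_le_of_walks blockWalkExpansion_mul)
open Summit.QuantumFields.BalabanUV.Gaps.D4WalkBlockNeumann (blockWalkExpansion_inv_pencil)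
open Summit.QuantumFields.BalabanUV.Gaps.D4WalkBlockGlue (blockWalkExpansion_one)

variable {ν : ℕ} {K : Fin ν → ℕ}

/-! ## §1. Block-norm lemmas: finite sums, cube-local left factors, the block letter of `V(u)·T` from derivative letters -/

section BlockLemmas
variable {p n q : Type} [Fintype p] [Fintype n] [Fintype q]
variable (cub : p → UT K) (cubn : n → UT K) (cubq : q → UT K)

/-- The zero matrix has zero blocks. -/
theorem blockNorm_zero (y y' : UT K) : blockNorm cub cubn (0 : Matrix p n ℂ) y y' = 0 :=
  le_antisymm (blockNorm_le_of_rowMass_le cub cubn 0 y y' le_rfl fun i _ => by simp [rowMass]) (blockNorm_nonneg cub cubn 0 y y')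

/-- **Finite sums**: `‖Σ_{μ∈s} M_μ‖_{y,y′} ≤ Σ_{μ∈s} ‖M_μ‖_{y,y′}`. -/
theorem blockNorm_sum_le {ι : Type*} (s : Finset ι) (M : ι → Matrix p n ℂ) (y y' : UT K) :
    blockNorm cub cubn (∑ μ ∈ s, M μ) y y' ≤ ∑ μ ∈ s, blockNorm cub cubn (M μ) y y' := by
  classical
  induction s using Finset.induction_on with
  | empty => simp [blockNorm_zero]
  | insert a s ha ih =>
      rw [Finset.sum_insert ha, Finset.sum_insert ha]
      exact (blockNorm_add_le cub cubn _ _ y y').trans (by gcongr)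

/-- A CUBE-LOCAL matrix (`a i k ≠ 0 ⟹ cub i = cubn k`: couples only indices located in one cube) has vanishing off-diagonal blocks. -/
theorem blockNorm_eq_zero_of_local (a : Matrix p n ℂ) (hloc : ∀ i k, a i k ≠ 0 → cub i = cubn k) {y y'' : UT K}
    (hy : y ≠ y'') : blockNorm cub cubn a y y'' = 0 := by
  refine le_antisymm (blockNorm_le_of_rowMass_le cub cubn a y y'' le_rfl fun i hi => ?_) (blockNorm_nonneg cub cubn a y y'')
  refine (Finset.sum_eq_zero fun k hk => ?_).le
  have hk' : cubn k = y'' := (Finset.mem_filter.1 hk).2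
  by_contra hne
  exact hy (hi.symm.trans ((hloc i k fun h0 => hne (by rw [h0, norm_zero])).trans hk'))

/-- **A CUBE-LOCAL LEFT FACTOR COSTS ITS DIAGONAL BLOCK BOUND AND NO CUBE SUM**: `a` cube-local with `‖a‖_{y,y} ≤ α` ⟹
`‖a·S‖_{y,y′} ≤ α·‖S‖_{y,y′}` (the shape of a multiplication operator by a site function, of a fibrewise `ad_{A′(b)}`, of the
coefficient `F′_{1,k}(i ad_{A′(b)})` of (3.51)). [cite: Balaban1985BackgroundPropagators, (3.51)–(3.52) p.400, (3.92)–(3.94) p.410] -/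
theorem blockNorm_localMul_le (a : Matrix q p ℂ) (S : Matrix p n ℂ) {α : ℝ} (hloc : ∀ i k, a i k ≠ 0 → cubq i = cub k)
    (hbd : ∀ y, blockNorm cubq cub a y y ≤ α) (y y' : UT K) :
    blockNorm cubq cubn (a * S) y y' ≤ α * blockNorm cub cubn S y y' := by
  classical
  calc blockNorm cubq cubn (a * S) y y'
      ≤ ∑ y'' : UT K, blockNorm cubq cub a y y'' * blockNorm cub cubn S y'' y' := blockNorm_mul_le cubq cub cubn a S y y'
    _ = blockNorm cubq cub a y y * blockNorm cub cubn S y y' := by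
        refine Finset.sum_eq_single y (fun y'' _ hne => ?_) (fun h => (h (Finset.mem_univ y)).elim)
        rw [blockNorm_eq_zero_of_local cubq cub a hloc (Ne.symm hne), zero_mul]
    _ ≤ α * blockNorm cub cubn S y y' := mul_le_mul_of_nonneg_right (hbd y) (blockNorm_nonneg cub cubn S y y')

/-- **(3.52) ⟹ THE (3.61)-SHAPE DOMINATION LETTER.**  `V = a₀ + Σ_μ a_μ·∇_μ` with `a₀`, `a_μ` CUBE-LOCAL of diagonal block
size `α₀`, `α_μ ≥ 0` and the `∇_μ : Matrix p n ℂ` ARBITRARY (covariant differences: size `η⁻¹`, never estimated) ⟹ for every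
`S`, `‖V·S‖_{y,y′} ≤ α₀‖S‖_{y,y′} + Σ_μ α_μ‖∇_μS‖_{y,y′}` — print's «|(V′(A)λ)(x)| ≤ O(1)α₁((Lʲη)⁻¹|∇_Uλ| + (Lʲη)⁻²|λ|) … the
norms on the right-hand side restricted to the block containing the point x» read in block currency (print's `Σ_{b∈st(x)}` is
written with the `2d` one-sided differences landing AT `x`, so every coefficient of (3.52) is site-local).
[cite: Balaban1985BackgroundPropagators, (3.52) p.400, (3.61) p.402] -/
theorem blockDominated_of_local {ι : Type*} [Fintype ι] (Dop : ι → Matrix p n ℂ) (a₀ : Matrix n n ℂ) (a : ι → Matrix n p ℂ)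
    {α₀ : ℝ} {α : ι → ℝ}
    (hloc₀ : ∀ i k, a₀ i k ≠ 0 → cubn i = cubn k) (hbd₀ : ∀ y, blockNorm cubn cubn a₀ y y ≤ α₀)
    (hloc : ∀ μ i k, a μ i k ≠ 0 → cubn i = cub k) (hbd : ∀ μ y, blockNorm cubn cub (a μ) y y ≤ α μ)
    (S : Matrix n n ℂ) (y y' : UT K) :
    blockNorm cubn cubn ((a₀ + ∑ μ, a μ * Dop μ) * S) y y' ≤
      α₀ * blockNorm cubn cubn S y y' + ∑ μ, α μ * blockNorm cub cubn (Dop μ * S) y y' := by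
  have e : (a₀ + ∑ μ, a μ * Dop μ) * S = a₀ * S + ∑ μ, a μ * (Dop μ * S) := by
    rw [Matrix.add_mul, Finset.sum_mul]
    exact congrArg _ (Finset.sum_congr rfl fun μ _ => Matrix.mul_assoc _ _ _)
  rw [e]
  exact (blockNorm_add_le cubn cubn _ _ y y').trans (add_le_add (blockNorm_localMul_le cubn cubn cubn a₀ S hloc₀ hbd₀ y y')
    ((blockNorm_sum_le cubn cubn _ _ y y').trans (Finset.sum_le_sum fun μ _ =>
      blockNorm_localMul_le cub cubn cubn (a μ) (Dop μ * S) (hloc μ) (hbd μ) y y')))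

/-- **THE BLOCK LETTER OF `V·T` FROM THE DOMINATION LETTER AND THE TERM's DERIVATIVE LETTERS — NO `‖∇_μ‖`**: `‖V·S‖ ≤ α₀‖S‖ +
Σ_μ α_μ‖∇_μS‖` blockwise ((3.61)-shape, `α ≥ 0`), `‖T‖_{y,y′} ≤ F(y,y′)` and RELATIVE DERIVATIVE LETTERS `‖∇_μT‖_{y,y′} ≤ B_μF(y,y′)`
⟹ `‖V·T‖_{y,y′} ≤ (α₀ + Σ_μ α_μB_μ)·F(y,y′)` — print's (3.63) from (3.61) and the derivative entries of (3.42).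
[cite: Balaban1985BackgroundPropagators, (3.61)–(3.63) p.402, Thm 3.1 (3.42) p.397] -/
theorem blockNorm_perturbTerm_le {ι : Type*} [Fintype ι] (Dop : ι → Matrix p n ℂ) (V T : Matrix n n ℂ)
    {α₀ : ℝ} {α B : ι → ℝ} {F : UT K → UT K → ℝ} (hα₀ : 0 ≤ α₀) (hα : ∀ μ, 0 ≤ α μ)
    (hV : ∀ S y y', blockNorm cubn cubn (V * S) y y' ≤
      α₀ * blockNorm cubn cubn S y y' + ∑ μ, α μ * blockNorm cub cubn (Dop μ * S) y y')
    (hT : ∀ y y', blockNorm cubn cubn T y y' ≤ F y y') (hD : ∀ μ y y', blockNorm cub cubn (Dop μ * T) y y' ≤ B μ * F y y')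
    (y y' : UT K) :
    blockNorm cubn cubn (V * T) y y' ≤ (α₀ + ∑ μ, α μ * B μ) * F y y' := by
  refine (hV T y y').trans ?_
  rw [add_mul, Finset.sum_mul]
  refine add_le_add (mul_le_mul_of_nonneg_left (hT y y') hα₀) (Finset.sum_le_sum fun μ _ => ?_)
  rw [mul_assoc]
  exact mul_le_mul_of_nonneg_left (hD μ y y') (hα μ)

end BlockLemmas
/-! ## §2. Left multiplication by a σ-independent holomorphic family; kernel congruence -/

section LeftMul
variable [∀ i, NeZero (K i)]
variable {d N' : ℕ} {p n : Type} [Fintype p] [Fintype n]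
variable {E : Type*} [NormedAddCommGroup E] [NormedSpace ℂ E]
variable {c : B13.Consts} {cub : p → UT K} {cubn : n → UT K} {K2 : (TPt d N' → ℂ) → E → Matrix n n ℂ}
variable {X : Finset (UT K)} {R ε kap Kbar : ℝ}
variable {W : Type} {T2 : W → (TPt d N' → ℂ) → E → Matrix n n ℂ} {SX : Set W} {A : W → ℝ}
variable {D : W → UT K → UT K → ℝ} {ρ : ℝ}

/-- **LEFT MULTIPLICATION BY A σ-INDEPENDENT HOLOMORPHIC FAMILY WITH A RELATIVE BLOCK LETTER IS A BLOCK WALK EXPANSION ON THE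
SAME WALKS**: `W = Σ_ω T_ω` block-walk-expanded, `V(u) : Matrix p n ℂ` entrywise holomorphic on the ball, `‖V(u)T_ω(σ,u)‖_{y,y′} ≤
θ·A_ωe^{−ρD_ω(y,y′)}` ⟹ `V(u)W(σ,u) = Σ_ω V(u)T_ω(σ,u)` is a block walk expansion with amplitudes `θA_ω`, constant `θK̄`, same walks ∕
distances ∕ rates ∕ window ∕ σ-carrying set (`V = ∇_μ`: a DERIVATIVE COMPANION; `V = V′(A)`: (3.63)). [cite: Balaban1985BackgroundPropagators, Thm 3.1 (3.42) p.397, (3.63) p.402, (3.107)–(3.108) p.416; Balaban1988RG2Cluster, (1.11) p.5, p.15] -/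
theorem _root_.Summit.QuantumFields.BalabanUV.Gaps.D4WalkBlock.BlockWalkExpansion.leftMul
    (h : BlockWalkExpansion c cubn cubn K2 X R ε kap Kbar T2 SX A D ρ)
    {V : E → Matrix p n ℂ} {θ : ℝ} (hθ : 0 ≤ θ)
    (hVan : ∀ i k, DifferentiableOn ℂ (fun u => V u i k) (ball (0 : E) R))
    (hVB : ∀ ω, ∀ σ : TPt d N' → ℂ, (∀ j, ‖σ j‖ ≤ Real.exp c.κ₁) → ∀ u ∈ ball (0 : E) R, ∀ y y',
      blockNorm cub cubn (V u * T2 ω σ u) y y' ≤ θ * (A ω * Real.exp (-(ρ * D ω y y')))) :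
    BlockWalkExpansion c cub cubn (fun σ u => V u * K2 σ u) X R ε kap (θ * Kbar)
      (fun ω σ u => V u * T2 ω σ u) SX (fun ω => θ * A ω) D ρ where
  hasSum σ hσ u hu i j := by
    have e : ∀ M : Matrix n n ℂ, (V u * M) i j = ∑ k, V u i k * M k j := fun M => Matrix.mul_apply
    simp only [e]
    exact hasSum_sum fun k _ => (h.hasSum σ hσ u hu k j).mul_left (V u i k)
  termAnalytic ω σ hσ i j := differentiableOn_mul_entry (fun i k => hVan i k) (fun k j => h.termAnalytic ω σ hσ k j) i j
  majB ω σ hσ u hu y y' := by rw [mul_assoc]; exact hVB ω σ hσ u hu y y'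
  majSum S a b := by
    have hS := h.majSum S a b
    calc ∑ ω ∈ S, θ * A ω * Real.exp (-((ρ - ε) * D ω a b))
        = θ * ∑ ω ∈ S, A ω * Real.exp (-((ρ - ε) * D ω a b)) := by
          rw [Finset.mul_sum]; exact Finset.sum_congr rfl fun ω _ => by ring
      _ ≤ θ * (Kbar * Real.exp (-(kap * tdist1 K a b))) := mul_le_mul_of_nonneg_left hS hθ
      _ = θ * Kbar * Real.exp (-(kap * tdist1 K a b)) := by ring
  indep ω hω σ hσ := by
    show V 0 * T2 ω σ 0 = V 0 * T2 ω 0 0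
    rw [h.indep ω hω σ hσ]
  through := h.through
  A_nonneg ω := mul_nonneg hθ (h.A_nonneg ω)
  D_nonneg := h.D_nonneg

omit [Fintype p] in
/-- Kernel congruence: a block walk expansion of `K` is one of any family agreeing with `K` on the σ-polydisc × ball. -/
theorem _root_.Summit.QuantumFields.BalabanUV.Gaps.D4WalkBlock.BlockWalkExpansion.congrK
    {K2' : (TPt d N' → ℂ) → E → Matrix p n ℂ} {cub' : p → UT K}
    {T2' : W → (TPt d N' → ℂ) → E → Matrix p n ℂ} {K2p : (TPt d N' → ℂ) → E → Matrix p n ℂ} [Fintype p]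
    (h : BlockWalkExpansion c cub' cubn K2p X R ε kap Kbar T2' SX A D ρ)
    (hK : ∀ σ : TPt d N' → ℂ, ∀ u : E, (∀ j, ‖σ j‖ ≤ Real.exp c.κ₁) → u ∈ ball (0 : E) R → K2' σ u = K2p σ u) :
    BlockWalkExpansion c cub' cubn K2' X R ε kap Kbar T2' SX A D ρ where
  hasSum σ hσ u hu i j := by rw [hK σ u hσ hu]; exact h.hasSum σ hσ u hu i j
  termAnalytic := h.termAnalytic
  majB := h.majB
  majSum := h.majSum
  indep := h.indep
  through := h.through
  A_nonneg := h.A_nonneg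
  D_nonneg := h.D_nonneg

/-! ## §3. A relative derivative letter of the left factor passes to a product -/

variable {K₁ K₂ : (TPt d N' → ℂ) → E → Matrix n n ℂ} {X : Finset (UT K)} {R : ℝ}
variable {W₁ W₂ : Type} {T₁ : W₁ → (TPt d N' → ℂ) → E → Matrix n n ℂ} {T₂ : W₂ → (TPt d N' → ℂ) → E → Matrix n n ℂ}
variable {SX₁ : Set W₁} {SX₂ : Set W₂} {A₁ : W₁ → ℝ} {A₂ : W₂ → ℝ}
variable {D₁ : W₁ → UT K → UT K → ℝ} {D₂ : W₂ → UT K → UT K → ℝ}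
variable {ρ₁ ρ₂ ε₁ ε₂ κ₁ κ₂ Kbar₁ Kbar₂ ρ σ cσ : ℝ}

/-- **A RELATIVE DERIVATIVE LETTER OF THE LEFT FACTOR PASSES TO THE PRODUCT UNCHANGED**: under the rate data of
`D4WalkBlockProduct.blockWalkExpansion_mul` (`0 ≤ ρ ≤ ρ₂`, `ρ + σ ≤ ρ₁`, cube row sum `(σ, c_σ)`), if `‖∇T₁ω₁‖_{y,y′} ≤
B·A₁ω₁e^{−ρ₁D₁ω₁}` then `‖∇(T₁ω₁·T₂ω₂)‖_{y,y′} ≤ B·(c_σA₁ω₁A₂ω₂)e^{−ρ(D₁ω₁ □ D₂ω₂)(y,y′)}` — `B` times the product's own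
amplitude (print: the derivative entries of (3.42) for a walk term, (3.108)). [cite: Balaban1985BackgroundPropagators, Thm 3.1 (3.42) p.397, (3.92)–(3.94) p.410, (3.108) p.416] -/
theorem derivLetter_mul (h₁ : BlockWalkExpansion c cubn cubn K₁ X R ε₁ κ₁ Kbar₁ T₁ SX₁ A₁ D₁ ρ₁)
    (h₂ : BlockWalkExpansion c cubn cubn K₂ X R ε₂ κ₂ Kbar₂ T₂ SX₂ A₂ D₂ ρ₂)
    (hdom₁ : ∀ ω, DomBy (toB6 (torusGeom K 0 0 0) 0 True) (D₁ ω))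
    (hrow : RowSum (toB6 (torusGeom K 0 0 0) 0 True) σ cσ)
    (hρ : 0 ≤ ρ) (hρ₂ : ρ ≤ ρ₂) (hσ : 0 ≤ σ) (hρ₁ : ρ + σ ≤ ρ₁)
    (Dop : Matrix p n ℂ) {B : ℝ} (hB : 0 ≤ B)
    (hD : ∀ ω, ∀ σ₀ : TPt d N' → ℂ, (∀ j, ‖σ₀ j‖ ≤ Real.exp c.κ₁) → ∀ u ∈ ball (0 : E) R, ∀ y y',
      blockNorm cub cubn (Dop * T₁ ω σ₀ u) y y' ≤ B * (A₁ ω * Real.exp (-(ρ₁ * D₁ ω y y')))) :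
    ∀ ω : W₁ × W₂, ∀ σ₀ : TPt d N' → ℂ, (∀ j, ‖σ₀ j‖ ≤ Real.exp c.κ₁) → ∀ u ∈ ball (0 : E) R, ∀ y y',
      blockNorm cub cubn (Dop * (T₁ ω.1 σ₀ u * T₂ ω.2 σ₀ u)) y y' ≤
        B * ((cσ * (A₁ ω.1 * A₂ ω.2)) *
          Real.exp (-(ρ * infConv (g := toB6 (torusGeom K 0 0 0) 0 True) (D₁ ω.1) (D₂ ω.2) y y'))) := by
  intro ω σ₀ hσ₀ u hu y y'
  rw [← Matrix.mul_assoc]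
  have h := blockNorm_mul_le_of_walks cub cubn cubn (M₁ := Dop * T₁ ω.1 σ₀ u) (M₂ := T₂ ω.2 σ₀ u)
    (mul_nonneg hB (h₁.A_nonneg ω.1)) (h₂.A_nonneg ω.2) hρ hρ₂ hσ hρ₁ (hdom₁ ω.1) (h₂.D_nonneg ω.2) hrow
    (fun y y'' => by rw [mul_assoc]; exact hD ω.1 σ₀ hσ₀ u hu y y'') (fun y'' y' => h₂.majB ω.2 σ₀ hσ₀ u hu y'' y') y y'
  calc _ ≤ _ := h
    _ = _ := by ring

end LeftMul
/-! ## §4. THE STEP: `W ↦ W(1 − VW)⁻¹` from an expansion of the composite `VW`, derivative letters carried along -/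

section Step
variable [∀ i, NeZero (K i)]
variable {d N' : ℕ} {p n : Type} [Fintype p] [Fintype n] [DecidableEq n]
variable {E : Type*} [NormedAddCommGroup E] [NormedSpace ℂ E]
variable {c₀ : B13.Consts} {cub : p → UT K} {cubn : n → UT K} {X : Finset (UT K)}
variable {K2 : (TPt d N' → ℂ) → E → Matrix n n ℂ} {W₀ : Type} {T2 : W₀ → (TPt d N' → ℂ) → E → Matrix n n ℂ}
variable {SX : Set W₀} {A : W₀ → ℝ} {D : W₀ → UT K → UT K → ℝ}
variable {PK : (TPt d N' → ℂ) → E → Matrix n n ℂ} {WP : Type} {TP : WP → (TPt d N' → ℂ) → E → Matrix n n ℂ}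
variable {SXP : Set WP} {AP : WP → ℝ} {DP : WP → UT K → UT K → ℝ}
variable {ι : Type*} {Dop : ι → Matrix p n ℂ} {B : ι → ℝ}
variable {R εW κW KbarW ρW KbarP μ cμ : ℝ}

/-- **THE PERTURBATION STEP (3.64) WITH DERIVATIVE LETTERS.**  `W(σ,u)` block-walk-expanded at `(ε_W, κ_W, K̄_W, ρ_W)` with dominating
distances and RELATIVE DERIVATIVE LETTERS `‖∇_μT_ω‖_{y,y′} ≤ B_μ·A_ωe^{−ρ_WD_ω(y,y′)}` for fixed matrices `∇_μ` (never estimated); the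
composite kernel `P(σ,u)` (print: `V′(A)G′(U)`) block-walk-expanded at the SAME rates with constant `K̄_P` and dominating distances; cube
row sum `(μ, c_μ)`; `0 ≤ μ`, `2μ ≤ ε_W`, `2μ ≤ κ_W`, `κ_W + μ ≤ ρ_W − ε_W`; MARGIN `q = c_μ(c_μ·1·(1·K̄_P)c_μ)c_μ < 1` ⟹ `W(1 − P)⁻¹` is a
block walk expansion at `(ε_W − 2μ, κ_W − 2μ)`, walk rate `ρ_W − 2μ`, constant `c_μK̄_W(1·(1−q)⁻¹)c_μ`, with dominating distances AND THE
SAME relative derivative letters `B_μ` on its terms (BY NAME: `blockWalkExpansion_one` → `blockWalkExpansion_inv_pencil` (`t = −1`) →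
`blockWalkExpansion_mul`; letters by `derivLetter_mul`). [cite: Balaban1985BackgroundPropagators, (3.62)–(3.65) pp.402–403, Thm 3.4 p.400, (3.92)–(3.94) p.410, (3.107)–(3.108) p.416; Balaban1988RG2Cluster, (1.11) p.5, p.13, p.15] -/
theorem blockWalkExpansion_perturb
    (hW : BlockWalkExpansion c₀ cubn cubn K2 X R εW κW KbarW T2 SX A D ρW)
    (hdom : ∀ ω, DomBy (toB6 (torusGeom K 0 0 0) 0 True) (D ω))
    (hB : ∀ μ, 0 ≤ B μ)
    (hD : ∀ μ ω, ∀ σ : TPt d N' → ℂ, (∀ j, ‖σ j‖ ≤ Real.exp c₀.κ₁) → ∀ u ∈ ball (0 : E) R, ∀ y y',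
      blockNorm cub cubn (Dop μ * T2 ω σ u) y y' ≤ B μ * (A ω * Real.exp (-(ρW * D ω y y'))))
    (hP : BlockWalkExpansion c₀ cubn cubn PK X R εW κW KbarP TP SXP AP DP ρW)
    (hPdom : ∀ ω, DomBy (toB6 (torusGeom K 0 0 0) 0 True) (DP ω))
    (hμ : 0 ≤ μ) (hμε : 2 * μ ≤ εW) (hμκ : 2 * μ ≤ κW) (hwin : κW + μ ≤ ρW - εW)
    (hKbar : 0 ≤ KbarW) (hKbarP : 0 ≤ KbarP) (hcμ : 0 ≤ cμ) (hrow : RowSum (toB6 (torusGeom K 0 0 0) 0 True) μ cμ)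
    (hq : cμ * (cμ * 1 * (1 * KbarP) * cμ) * cμ < 1) :
    ∃ (W : Type) (T : W → (TPt d N' → ℂ) → E → Matrix n n ℂ) (SX' : Set W) (A' : W → ℝ) (D' : W → UT K → UT K → ℝ),
      BlockWalkExpansion c₀ cubn cubn (fun σ u => K2 σ u * (1 - PK σ u)⁻¹) X R (εW - 2 * μ) (κW - 2 * μ)
        (cμ * KbarW * (1 * (1 - cμ * (cμ * 1 * (1 * KbarP) * cμ) * cμ)⁻¹) * cμ) T SX' A' D' (ρW - 2 * μ) ∧
      (∀ μ' ω, ∀ σ : TPt d N' → ℂ, (∀ j, ‖σ j‖ ≤ Real.exp c₀.κ₁) → ∀ u ∈ ball (0 : E) R, ∀ y y',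
        blockNorm cub cubn (Dop μ' * T ω σ u) y y' ≤ B μ' * (A' ω * Real.exp (-((ρW - 2 * μ) * D' ω y y')))) ∧
      ∀ ω, DomBy (toB6 (torusGeom K 0 0 0) 0 True) (D' ω) := by
  have hεW : 0 ≤ εW := by linarith
  have hκW : 0 ≤ κW := by linarith
  -- (i) N = (1 − P)⁻¹ = (1 + (−1)•P)⁻¹ by the Neumann step from the identity seed
  have hone := blockWalkExpansion_one (d := d) (N' := N') (E := E) c₀ cubn X R εW (ρW - εW)
  have hN := blockWalkExpansion_inv_pencil (A := fun (_ : TPt d N' → ℂ) (_ : E) => (1 : Matrix n n ℂ))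
    (t := (-1 : ℂ)) (τ := 1) (ρ := ρW - 2 * μ) (ε := εW - 2 * μ) (ρs := ρW - μ) (κs := κW - μ) (κ := κW - 2 * μ)
    hone hP (fun _ a b => le_rfl) hPdom (fun σ₀ _ u _ => Matrix.one_mul _) hrow hrow hμ hμ hcμ hcμ
    (by linarith) (by linarith) (by linarith) (by linarith) (by linarith) (by linarith) (by linarith) zero_le_one hKbarP
    (by linarith) (by linarith) (by linarith) (by linarith) (by linarith) (by linarith) zero_le_one (by simp) hq
  have hq1 : 0 < 1 - cμ * (cμ * 1 * (1 * KbarP) * cμ) * cμ := by linarith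
  have hNdom : ∀ ω : List (Unit × WP) × Unit, DomBy (toB6 (torusGeom K 0 0 0) 0 True)
      (chainDist (g := toB6 (torusGeom K 0 0 0) 0 True)
        (fun i : Unit × WP => infConv (g := toB6 (torusGeom K 0 0 0) 0 True) (tdist1 K) (DP i.2)) (tdist1 K) ω.1) :=
    fun ω => domBy_chain (DC := fun _ : Unit => tdist1 K) (fun _ a b => le_rfl) hPdom ω
  -- (ii) W·N (W pays the cube row sum) and its derivative letters (W is the differentiated factor)
  have hK := blockWalkExpansion_mul (ρ := ρW - 2 * μ) (ε := εW - 2 * μ) (κ := κW - 2 * μ) hW hN hdom hNdom hrow hrow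
    (by linarith) le_rfl hμ (by linarith) (by linarith) (by linarith) (by linarith) hKbar (by positivity)
    (by linarith) le_rfl (by linarith) hcμ
  have hKD := fun μ' => derivLetter_mul (ρ := ρW - 2 * μ) hW hN hdom hrow (by linarith) le_rfl hμ (by linarith)
    (Dop μ') (hB μ') (hD μ')
  refine ⟨_, _, _, _, _, hK.congrK fun σ u _ _ => ?_, hKD,
    fun ω => domBy_infConv_torus (hdom ω.1) (hNdom ω.2)⟩
  simp only [neg_one_smul, sub_eq_add_neg]

/-! ## §5. THE STEP FROM THE LETTERS (3.61) ∕ (3.42): margin «`α₁` sufficiently small» against `(c_μ, K̄_W, B_μ)` only -/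

variable [Fintype ι] {V : E → Matrix n n ℂ} {α₀ : ℝ} {α : ι → ℝ}

omit [Fintype n] [DecidableEq n] in
/-- Entrywise holomorphy of a (3.52)-shaped `V(u) = a₀(u) + Σ_μ a_μ(u)·∇_μ` from that of its coefficients. [cite: Balaban1985BackgroundPropagators, p.400 («F′_{1,k}(iad_{A′(b)}) is an analytic function of A(b)»), p.402 («It is an analytic function of A on the domain (3.37)»)] -/
theorem differentiableOn_perturb_entry {a₀ : E → Matrix n n ℂ} {a : ι → E → Matrix n p ℂ}
    (ha₀ : ∀ i k, DifferentiableOn ℂ (fun u => a₀ u i k) (ball (0 : E) R))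
    (ha : ∀ μ i l, DifferentiableOn ℂ (fun u => a μ u i l) (ball (0 : E) R)) (i k : n) :
    DifferentiableOn ℂ (fun u => (a₀ u + ∑ μ, a μ u * Dop μ) i k) (ball (0 : E) R) := by
  have e : (fun u => (a₀ u + ∑ μ, a μ u * Dop μ) i k) = fun u => a₀ u i k + ∑ μ, (a μ u * Dop μ) i k := by
    funext u; rw [Matrix.add_apply, Matrix.sum_apply]
  rw [e]
  exact (ha₀ i k).add (DifferentiableOn.fun_sum fun μ _ =>
    differentiableOn_mul_entry (M₂ := fun _ => Dop μ) (ha μ) (fun _ _ => differentiableOn_const _) i k)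

/-- **[B9] SECT. B's STEP (3.60)–(3.64) IN BLOCK CURRENCY — THE MARGIN IS «α₁ SUFFICIENTLY SMALL» AND CONTAINS NO `‖∇_μ‖`.**
`W(σ,u)` (print: `G′(U)`) block-walk-expanded at `(ε_W, κ_W, K̄_W, ρ_W)` with dominating distances and RELATIVE DERIVATIVE LETTERS
`B_μ ≥ 0` for fixed matrices `∇_μ : Matrix p n ℂ` — ARBITRARY: print's covariant differences (size `η⁻¹`) enter ONLY through these
letters (the derivative entries of (3.42)); the perturbation `V(u)` (print: `V′(A)`), σ-independent, entrywise holomorphic, with the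
(3.61)-shape DOMINATION LETTER `‖V(u)S‖_{y,y′} ≤ α₀‖S‖_{y,y′} + Σ_μ α_μ‖∇_μS‖_{y,y′}`, `α ≥ 0` (from a (3.52)-structure: §1
`blockDominated_of_local`); cube row sum `(μ, c_μ)`; `0 ≤ μ`, `2μ ≤ ε_W`, `2μ ≤ κ_W`, `κ_W + μ ≤ ρ_W − ε_W`; MARGIN
`q = c_μ(c_μ·1·(1·((α₀ + Σ_μ α_μB_μ)K̄_W))c_μ)c_μ < 1` («for α₁ sufficiently small … I − V′(A)G′(U) is an invertible operator, the
inverse is given by a convergent Neumann series», p. 402) ⟹ `W(1 − VW)⁻¹` ((3.64)) is a block walk expansion at `(ε_W − 2μ, κ_W − 2μ)`,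
walk rate `ρ_W − 2μ`, constant `c_μK̄_W(1·(1−q)⁻¹)c_μ`, dominating distances, THE SAME relative derivative letters `B_μ` — the INPUT
SHAPE again (the step iterates: print perturbs around a general `U`) — and no constant depends on `∇_μ`: k-UNIFORM given k-uniform
`(α, B_μ, K̄_W, c_μ)` («of course with different constants, although changes are small», p. 403).  `= §1 → §2 → §4`.
[cite: Balaban1985BackgroundPropagators, (3.60)–(3.65) pp.402–403, Thm 3.4 p.400, Cor. 3.5 p.407, p.399, Thm 3.1 (3.42) p.397, (3.107)–(3.108) p.416; Balaban1984PropagatorsII, Prop. 2.2 (2.67) p.234; Balaban1988RG2Cluster, (1.11) p.5, p.15] -/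
theorem blockWalkExpansion_perturb_of_derivLetters
    (hW : BlockWalkExpansion c₀ cubn cubn K2 X R εW κW KbarW T2 SX A D ρW)
    (hdom : ∀ ω, DomBy (toB6 (torusGeom K 0 0 0) 0 True) (D ω))
    (hB : ∀ μ, 0 ≤ B μ)
    (hD : ∀ μ ω, ∀ σ : TPt d N' → ℂ, (∀ j, ‖σ j‖ ≤ Real.exp c₀.κ₁) → ∀ u ∈ ball (0 : E) R, ∀ y y',
      blockNorm cub cubn (Dop μ * T2 ω σ u) y y' ≤ B μ * (A ω * Real.exp (-(ρW * D ω y y'))))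
    (hVan : ∀ i k, DifferentiableOn ℂ (fun u => V u i k) (ball (0 : E) R))
    (hα₀ : 0 ≤ α₀) (hα : ∀ μ, 0 ≤ α μ)
    (hV : ∀ u ∈ ball (0 : E) R, ∀ S y y', blockNorm cubn cubn (V u * S) y y' ≤
      α₀ * blockNorm cubn cubn S y y' + ∑ μ', α μ' * blockNorm cub cubn (Dop μ' * S) y y')
    (hμ : 0 ≤ μ) (hμε : 2 * μ ≤ εW) (hμκ : 2 * μ ≤ κW) (hwin : κW + μ ≤ ρW - εW)
    (hKbar : 0 ≤ KbarW) (hcμ : 0 ≤ cμ) (hrow : RowSum (toB6 (torusGeom K 0 0 0) 0 True) μ cμ)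
    (hq : cμ * (cμ * 1 * (1 * ((α₀ + ∑ μ', α μ' * B μ') * KbarW)) * cμ) * cμ < 1) :
    ∃ (W : Type) (T : W → (TPt d N' → ℂ) → E → Matrix n n ℂ) (SX' : Set W) (A' : W → ℝ) (D' : W → UT K → UT K → ℝ),
      BlockWalkExpansion c₀ cubn cubn (fun σ u => K2 σ u * (1 - V u * K2 σ u)⁻¹) X R (εW - 2 * μ) (κW - 2 * μ)
        (cμ * KbarW * (1 * (1 - cμ * (cμ * 1 * (1 * ((α₀ + ∑ μ', α μ' * B μ') * KbarW)) * cμ) * cμ)⁻¹) * cμ)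
        T SX' A' D' (ρW - 2 * μ) ∧
      (∀ μ' ω, ∀ σ : TPt d N' → ℂ, (∀ j, ‖σ j‖ ≤ Real.exp c₀.κ₁) → ∀ u ∈ ball (0 : E) R, ∀ y y',
        blockNorm cub cubn (Dop μ' * T ω σ u) y y' ≤ B μ' * (A' ω * Real.exp (-((ρW - 2 * μ) * D' ω y y')))) ∧
      ∀ ω, DomBy (toB6 (torusGeom K 0 0 0) 0 True) (D' ω) := by
  have hθ : 0 ≤ α₀ + ∑ μ', α μ' * B μ' := add_nonneg hα₀ (Finset.sum_nonneg fun μ' _ => mul_nonneg (hα μ') (hB μ'))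
  -- P = V·W on W's own walks with the relative letter θ = α₀ + Σ α_μ B_μ (§1), as a block walk expansion (§2) — (3.63)
  have hP := hW.leftMul (cub := cubn) hθ hVan
    (fun ω σ hσ u hu y y' => blockNorm_perturbTerm_le cub cubn Dop (V u) (T2 ω σ u)
      (F := fun y y' => A ω * Real.exp (-(ρW * D ω y y'))) hα₀ hα (hV u hu) (hW.majB ω σ hσ u hu)
      (fun μ' => hD μ' ω σ hσ u hu) y y')
  exact blockWalkExpansion_perturb hW hdom hB hD hP hdom hμ hμε hμκ hwin hKbar (mul_nonneg hθ hKbar) hcμ hrow hq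

end Step

/-! ## §6. At `s ≡ 1`: `W(1 − VW)⁻¹ = (Δ − V)⁻¹` -/

section KernelOne
variable {n : Type} [Fintype n] [DecidableEq n]

/-- **RESUMMATION (3.62) ∕ (3.64)**: `Δ·W = 1` and `1 − V·W` invertible ⟹ `W(1 − VW)⁻¹ = (Δ − V)⁻¹` — for `Δ = Δ′_a(U)`, `W = G′(U)`,
`V = V′(A)`: `G′(U)(I − V′(A)G′(U))⁻¹ = (Δ′_a(U) − V′(A))⁻¹ = G′(U′U)` by (3.60). [cite: Balaban1985BackgroundPropagators, (3.60)–(3.64) p.402] -/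
theorem perturb_kernel_eq_inv (Δ W V : Matrix n n ℂ) (hΔW : Δ * W = 1) (hunit : IsUnit (1 - V * W).det) :
    W * (1 - V * W)⁻¹ = (Δ - V)⁻¹ := by
  symm
  refine Matrix.inv_eq_right_inv ?_
  calc (Δ - V) * (W * (1 - V * W)⁻¹) = (Δ * W - V * W) * (1 - V * W)⁻¹ := by rw [← Matrix.mul_assoc, Matrix.sub_mul]
    _ = (1 - V * W) * (1 - V * W)⁻¹ := by rw [hΔW]
    _ = 1 := Matrix.mul_nonsing_inv _ hunit

end KernelOne

end Summit.QuantumFields.BalabanUV.Gaps.D4WalkBlockDerivative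

end
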